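import Summits.HubbardSuperconductivity.HubbardSuperconductivity.Theorems.DeformationLadderLowEnergyRigiditySpinSqueezeKinematic
import Literature.MathematicalPhysics.QuantumLattice.HubbardSzSectorLadder

/-!
# `LowEnergyRigidity` (crux stmt-HubbardSuperconductivity-1892, route `DeformationLadder`), spin squeeze II:
# `Re⟨φ, Δ_dᴴΔ_d φ⟩ ≤ 32 L² (N/2 - S) ‖φ‖²` for total-spin-`S` vectors of `szSector N 0`

Second of three negative-side support files (line lead a1; the typed hand-off
`re_expect_pairField_le_of_spinSq` of crux-ideate r2 k6, `SketchIdeator6.lean`, here PROVED with the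
elementary constant `32`, every side `L ≥ 1`).

* `ss_bound_of_spinSq` — the `SU(2)` raising argument inside the coordinate sectors `(N↑, N↓)`: if `T`
  commutes with `S⁻` and obeys `Re⟨ψ, Tψ⟩ ≤ C · N↓ · ‖ψ‖²` on every sector, then for every `S²`-eigenvector
  `φ` of the sector `(a, b)` with eigenvalue `S(S+1)`, `S ≥ 0`: `Re⟨φ, Tφ⟩ ≤ C((a+b)/2 - S)‖φ‖²`
  (induction on `b`: `⟨S⁺φ, T S⁺φ⟩ = μ⟨φ, Tφ⟩`, `‖S⁺φ‖² = μ‖φ‖²`, `μ = S(S+1) - m(m+1)`, `m = (a-b)/2`;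
  at the highest weight `S⁺φ = 0` forces `m = S`, i.e. `N↓ = (a+b)/2 - S`).
* `re_expect_pairField_le_of_spinSq` — **the total-spin squeeze of the `d`-wave pair field**: for
  `φ ∈ szSector N 0` on the fermionic torus of side `L` with `S² φ = S(S+1) φ`, `S ≥ 0`,
  `Re⟨φ, Δ_dᴴ Δ_d φ⟩ ≤ 32 L² (N/2 - S) ‖φ‖²`. `d`-wave LRO density `≥ a` thus forces `S ≤ N/2 - aL²/32`;
  the saturated case `S = N/2` (`Δ_d φ = 0`) is route NoGo's `pairField_mulVec_eq_zero_of_saturated`.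

Sequel: `…SpinSqueezeWindow` (consequences for the rigidity matrix of the crux). Nothing is (re)defined.

References: H. Tasaki, *Physics and Mathematics of Quantum Many-Body Systems* (2020) §2.4 (raising and
lowering, norm identity; Wigner–Eckart for a scalar), §9.3; H. Tasaki, Prog. Theor. Phys. 99 (1998) 489,
p. 20; E. H. Lieb, PRL 62 (1989) 1201 (sectors, `S ≤ N/2`). Folklore.
-/

set_option linter.dupNamespace false

noncomputable section

namespace Summit.HubbardSuperconductivity.HubbardSuperconductivity.Theorems.DeformationLadder

open Matrix Finset Literature.MathematicalPhysics.QuantumLattice Literature.Probability.LatticeModels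
open scoped Matrix.Norms.L2Operator ComplexOrder

/-! ### The `SU(2)` raising argument inside the sectors `(N↑, N↓)` -/

section Raising

variable {Λ : Type*} [LinearOrder Λ] [Fintype Λ]

/-- `S⁻ S⁺ φ = (λ - m² - m) φ` for an `S²`-eigenvector `φ` (eigenvalue `λ`) of the sector `(a, b)`,
`m = (a - b)/2` (`S⁻S⁺ = S² - (S^z)² - S^z`). Tasaki (2020) §2.4, (2.4.9). [folklore] -/
theorem ss_spinMinus_spinPlus_mulVec {a b : ℕ} {φ : Fock (Orb Λ)} {lam : ℝ}
    (hφ : IsInSector a b φ) (hS : spinSq *ᵥ φ = (lam : ℂ) • φ) :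
    spinMinus *ᵥ (spinPlus *ᵥ φ) =
      ((lam - (((a : ℝ) - b) / 2) * (((a : ℝ) - b) / 2) - ((a : ℝ) - b) / 2 : ℝ) : ℂ) • φ := by
  have hZ := LiebThm1.spinZ_mulVec_of_isInSector hφ
  rw [mulVec_mulVec, Summit.HubbardSuperconductivity.NoGo.spinMinus_mul_spinPlus_eq, sub_mulVec,
    sub_mulVec, ← mulVec_mulVec, hZ, mulVec_smul, hZ, hS, smul_smul, ← sub_smul, ← sub_smul]
  congr 1
  push_cast
  ring

/-- `0 < Re⟨φ, φ⟩` for `φ ≠ 0`. [folklore] -/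
theorem ss_re_star_dotProduct_self_pos {ι : Type*} [Fintype ι] {φ : ι → ℂ} (hφ : φ ≠ 0) :
    0 < (star φ ⬝ᵥ φ).re := by
  have h : 0 < star φ ⬝ᵥ φ := Matrix.dotProduct_star_self_pos_iff.2 hφ
  exact (Complex.lt_def.1 h).1

/-- **Highest-weight step.** Let `T` obey the sector bound `Re⟨ψ, Tψ⟩ ≤ C · N↓ · ‖ψ‖²` on every
sector `(N↑, N↓)`. If `φ` lies in the sector `(a, b)`, `S² φ = S(S+1) φ` with `S ≥ 0`, and
`S⁺ φ = 0`, then `Re⟨φ, Tφ⟩ ≤ C ((a+b)/2 - S) ‖φ‖²`: for `φ ≠ 0` one has `a ≥ b` (`S⁺` is injective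
on `a < b`), `S(S+1) = m(m+1)` with `m = (a-b)/2 ≥ 0` (norm identity of `S⁺`), hence `S = m` and
`N↓ = b = (a+b)/2 - S`. Tasaki (2020) §2.4. [folklore] -/
theorem ss_bound_of_spinPlus_eq_zero (T : Matrix (Finset (Orb Λ)) (Finset (Orb Λ)) ℂ) (C : ℝ)
    (hT : ∀ (a b : ℕ) (ψ : Fock (Orb Λ)), IsInSector a b ψ →
      (star ψ ⬝ᵥ (T *ᵥ ψ)).re ≤ C * b * (star ψ ⬝ᵥ ψ).re)
    {a b : ℕ} {φ : Fock (Orb Λ)} {S : ℝ} (hφ : IsInSector a b φ)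
    (hS : spinSq *ᵥ φ = ((S * (S + 1) : ℝ) : ℂ) • φ) (hS0 : 0 ≤ S) (hP : spinPlus *ᵥ φ = 0) :
    (star φ ⬝ᵥ (T *ᵥ φ)).re ≤ C * (((a : ℝ) + b) / 2 - S) * (star φ ⬝ᵥ φ).re := by
  by_cases h0 : φ = 0
  · subst h0; simp
  have hnorm : 0 < (star φ ⬝ᵥ φ).re := ss_re_star_dotProduct_self_pos h0
  -- `a ≥ b`
  have hab : b ≤ a := by
    by_contra hlt
    exact h0 (LiebThm1.eq_zero_of_spinPlus_mulVec_eq_zero (not_le.1 hlt) hφ hP)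
  -- `S(S+1) = m(m+1)`
  have hμ : S * (S + 1) - (((a : ℝ) - b) / 2) * (((a : ℝ) - b) / 2) - ((a : ℝ) - b) / 2 = 0 := by
    have h := Summit.HubbardSuperconductivity.NoGo.star_spinPlus_mulVec_dotProduct hφ hS
    rw [hP, dotProduct_zero] at h
    have hcoef : (((S * (S + 1) : ℝ) : ℂ) - (1 / 2 * ((a : ℂ) - (b : ℂ))) * (1 / 2 * ((a : ℂ) - (b : ℂ))) -
        1 / 2 * ((a : ℂ) - (b : ℂ))) =
        ((S * (S + 1) - (((a : ℝ) - b) / 2 * (((a : ℝ) - b) / 2)) - ((a : ℝ) - b) / 2 : ℝ) : ℂ) := by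
      push_cast; ring
    rw [hcoef] at h
    have h2 := (mul_eq_zero.1 h.symm).resolve_right (fun h3 => by
      rw [h3, Complex.zero_re] at hnorm; exact lt_irrefl _ hnorm)
    have h3 := Complex.ofReal_eq_zero.1 h2
    linarith
  have hm0 : (0 : ℝ) ≤ ((a : ℝ) - b) / 2 := by
    have : (b : ℝ) ≤ a := by exact_mod_cast hab
    linarith
  have hSm : S = ((a : ℝ) - b) / 2 := by nlinarith
  have hb : C * b = C * (((a : ℝ) + b) / 2 - S) := by rw [hSm]; ring
  have h := hT a b φ hφ
  rwa [hb] at h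

/-- **The raising induction.** Let `T` commute with `S⁻` and obey the sector bound
`Re⟨ψ, Tψ⟩ ≤ C · N↓ · ‖ψ‖²`. Then for every `S²`-eigenvector `φ` of the sector `(a, b)` with
eigenvalue `S(S+1)`, `S ≥ 0`: `Re⟨φ, Tφ⟩ ≤ C ((a+b)/2 - S) ‖φ‖²`. Induction on `b`: either
`S⁺φ = 0` (highest-weight step) or `φ' = S⁺φ ≠ 0` lies in `(a+1, b-1)` with the same `S²`-eigenvalue,
`‖φ'‖² = μ‖φ‖²` and `⟨φ', Tφ'⟩ = ⟨φ, S⁻ T S⁺ φ⟩ = μ⟨φ, Tφ⟩` with `μ = S(S+1) - m(m+1) > 0`.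
Tasaki (2020) §2.4 (raising/lowering in a spin multiplet; Wigner–Eckart for a scalar operator). [folklore] -/
theorem ss_bound_of_spinSq (T : Matrix (Finset (Orb Λ)) (Finset (Orb Λ)) ℂ) (C : ℝ)
    (hT : ∀ (a b : ℕ) (ψ : Fock (Orb Λ)), IsInSector a b ψ →
      (star ψ ⬝ᵥ (T *ᵥ ψ)).re ≤ C * b * (star ψ ⬝ᵥ ψ).re)
    (hTM : Commute spinMinus T) :
    ∀ (b a : ℕ) (φ : Fock (Orb Λ)) (S : ℝ), IsInSector a b φ →
      spinSq *ᵥ φ = ((S * (S + 1) : ℝ) : ℂ) • φ → 0 ≤ S →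
      (star φ ⬝ᵥ (T *ᵥ φ)).re ≤ C * (((a : ℝ) + b) / 2 - S) * (star φ ⬝ᵥ φ).re := by
  intro b
  induction b with
  | zero =>
    intro a φ S hφ hS hS0
    exact ss_bound_of_spinPlus_eq_zero T C hT hφ hS hS0 (LiebThm1.raisesSpin_spinPlus.mulVec_eq_zero hφ)
  | succ b ih =>
    intro a φ S hφ hS hS0
    by_cases hP : spinPlus *ᵥ φ = 0
    · exact ss_bound_of_spinPlus_eq_zero T C hT hφ hS hS0 hP
    -- the raised vector
    have hφ' : IsInSector (a + 1) b (spinPlus *ᵥ φ) := LiebThm1.raisesSpin_spinPlus.isInSector_mulVec hφ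
    have hS' : spinSq *ᵥ (spinPlus *ᵥ φ) = ((S * (S + 1) : ℝ) : ℂ) • (spinPlus *ᵥ φ) := by
      have hc : (spinSq * spinPlus : Matrix (Finset (Orb Λ)) (Finset (Orb Λ)) ℂ) = spinPlus * spinSq := by
        rw [← LiebTwo.su2Casimir_spin_eq_spinSq]; exact LiebTwo.isSu2Triple_spin.su2Casimir_mul_P
      rw [mulVec_mulVec, hc, ← mulVec_mulVec, hS, mulVec_smul]
    have ih' := ih (a + 1) (spinPlus *ᵥ φ) S hφ' hS' hS0
    -- the factor `μ`
    set μ : ℝ := S * (S + 1) - (((a : ℝ) - (b + 1 : ℕ)) / 2) * (((a : ℝ) - (b + 1 : ℕ)) / 2) -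
      ((a : ℝ) - (b + 1 : ℕ)) / 2 with hμ
    have hnorm' : star (spinPlus *ᵥ φ) ⬝ᵥ (spinPlus *ᵥ φ) = (μ : ℂ) * (star φ ⬝ᵥ φ) := by
      rw [Summit.HubbardSuperconductivity.NoGo.star_spinPlus_mulVec_dotProduct hφ hS, hμ]
      congr 1; push_cast; ring
    have hT' : star (spinPlus *ᵥ φ) ⬝ᵥ (T *ᵥ (spinPlus *ᵥ φ)) = (μ : ℂ) * (star φ ⬝ᵥ (T *ᵥ φ)) := by
      rw [LiebTwo.isSu2Triple_spin.star_P_mulVec_dotProduct, mulVec_mulVec, hTM.eq, ← mulVec_mulVec,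
        ss_spinMinus_spinPlus_mulVec hφ hS, mulVec_smul, dotProduct_smul, smul_eq_mul]
    -- `μ > 0` because `S⁺ φ ≠ 0`
    have hpos' : 0 < (star (spinPlus *ᵥ φ) ⬝ᵥ (spinPlus *ᵥ φ)).re := ss_re_star_dotProduct_self_pos hP
    have hn0 : 0 ≤ (star φ ⬝ᵥ φ).re := by rw [← eucNorm_sq]; positivity
    have hμpos : 0 < μ := by
      rw [hnorm', Complex.re_ofReal_mul] at hpos'
      by_contra hle
      have : μ * (star φ ⬝ᵥ φ).re ≤ 0 := mul_nonpos_of_nonpos_of_nonneg (not_lt.1 hle) hn0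
      linarith
    -- transport the bound down
    rw [hT', hnorm', Complex.re_ofReal_mul, Complex.re_ofReal_mul] at ih'
    have hcast : (((a + 1 : ℕ) : ℝ) + (b : ℕ)) / 2 = ((a : ℝ) + ((b + 1 : ℕ) : ℝ)) / 2 := by
      push_cast; ring
    rw [hcast] at ih'
    have key : μ * (star φ ⬝ᵥ (T *ᵥ φ)).re ≤
        μ * (C * (((a : ℝ) + ((b + 1 : ℕ) : ℝ)) / 2 - S) * (star φ ⬝ᵥ φ).re) := by
      calc μ * (star φ ⬝ᵥ (T *ᵥ φ)).re
          ≤ C * (((a : ℝ) + ((b + 1 : ℕ) : ℝ)) / 2 - S) * (μ * (star φ ⬝ᵥ φ).re) := ih'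
        _ = μ * (C * (((a : ℝ) + ((b + 1 : ℕ) : ℝ)) / 2 - S) * (star φ ⬝ᵥ φ).re) := by ring
    exact le_of_mul_le_mul_left key hμpos

/-- A vector of the joint sector `(N, S^z = 0)` lies in the coordinate sector `(N/2, N/2)` (for
odd `N` it vanishes, so the statement holds with natural-number division). Lieb, PRL 62 (1989)
1201, proof of Theorem 1. [folklore] -/
theorem ss_isInSector_of_mem_szSector_zero {N : ℕ} {φ : Fock (Orb Λ)}
    (hφ : φ ∈ szSector N 0) : IsInSector (N / 2) (N / 2) φ := by
  rw [mem_szSector_iff] at hφ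
  obtain ⟨hN, hZ⟩ := hφ
  intro s hs
  by_contra hψ
  have hcard : s.card = N := by
    by_contra hc; exact hψ (hN s hc)
  have h := congrFun hZ s
  rw [LiebThm1.spinZ_mulVec_apply, Pi.smul_apply, smul_eq_mul, Complex.ofReal_zero, zero_mul] at h
  have h2 : ((upPart s).card : ℂ) - ((downPart s).card : ℂ) = 0 := by
    have := mul_eq_zero.1 h
    rcases this with h3 | h3
    · rcases mul_eq_zero.1 h3 with h4 | h4
      · norm_num at h4
      · exact h4
    · exact absurd h3 hψ
  have h3 : (upPart s).card = (downPart s).card := by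
    have h4 : ((upPart s).card : ℂ) = ((downPart s).card : ℂ) := sub_eq_zero.1 h2
    exact_mod_cast h4
  have hsum : (upPart s).card + (downPart s).card = N := by
    rw [← card_eq_upPart_add_downPart, hcard]
  exact hs ⟨by omega, by omega⟩

end Raising

/-! ### The total-spin squeeze of the `d`-wave pair field -/

section Squeeze

variable (L : ℕ) [NeZero L]

/-- `S⁺` commutes with the pair field `Δ_g` (a sum of singlet pairs). Tasaki (1998) p. 20. [folklore] -/
theorem ss_spinPlus_commute_pairField (g : Site 2 → ℝ) :
    Commute (spinPlus : Matrix (Finset (Orb (FermionTorus 2 L))) _ ℂ) (pairField g L) := by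
  rw [pairField]
  refine Commute.sum_right _ _ _ fun x _ => ?_
  rw [localPair]
  exact Commute.sum_right _ _ _ fun e _ =>
    (Summit.HubbardSuperconductivity.NoGo.spinPlus_commute_singletPair _ _).smul_right _

/-- `S⁻` commutes with the pair field `Δ_g`. Tasaki (1998) p. 20. [folklore] -/
theorem ss_spinMinus_commute_pairField (g : Site 2 → ℝ) :
    Commute (spinMinus : Matrix (Finset (Orb (FermionTorus 2 L))) _ ℂ) (pairField g L) := by
  rw [pairField]
  refine Commute.sum_right _ _ _ fun x _ => ?_
  rw [localPair]
  exact Commute.sum_right _ _ _ fun e _ =>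
    (Summit.HubbardSuperconductivity.NoGo.spinMinus_commute_singletPair _ _).smul_right _

/-- `S⁻` commutes with `Δ_gᴴ Δ_g` (`[S⁻, Δ_g] = 0` and `[S⁺, Δ_g]ᴴ = 0`). [folklore] -/
theorem ss_spinMinus_commute_pairField_conjTranspose_mul (g : Site 2 → ℝ) :
    Commute (spinMinus : Matrix (Finset (Orb (FermionTorus 2 L))) _ ℂ)
      ((pairField g L)ᴴ * pairField g L) := by
  have hP := ss_spinPlus_commute_pairField L g
  have hM := ss_spinMinus_commute_pairField L g
  have hPt : Commute (spinMinus : Matrix (Finset (Orb (FermionTorus 2 L))) _ ℂ) (pairField g L)ᴴ := by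
    have h := congrArg conjTranspose hP.eq
    rw [conjTranspose_mul, conjTranspose_mul] at h
    exact h.symm
  exact hPt.mul_right hM

end Squeeze

section SqueezeMain

/-- **The total-spin squeeze of the `d`-wave pair field** (crux stmt-HubbardSuperconductivity-1892,
negative side; the typed hand-off `re_expect_pairField_le_of_spinSq` of crux-ideate r2 k6 with the
elementary constant `32`). For a vector `φ` of the joint sector `(N, S^z = 0)` on the fermionic torus of
side `L` which is a total-spin eigenvector, `S² φ = S(S+1) φ`, `S ≥ 0`:
`Re⟨φ, Δ_dᴴ Δ_d φ⟩ ≤ 32 L² (N/2 - S) ‖φ‖²`.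
In words: `d`-wave LRO density `≥ a` forces `S ≤ N/2 - aL²/32`; the singlet pair field is squeezed
out by polarisation. (Kinematic bound `‖Δ_d ψ‖² ≤ 32 L² N↓ ‖ψ‖²` on every sector `(N↑, N↓)`, then
`SU(2)` raising to the highest weight, `Δ_dᴴΔ_d` being a scalar.) Tasaki, Prog. Theor. Phys. 99
(1998) 489, p. 20 (saturated case); Tasaki (2020) §2.4. [folklore] -/
theorem re_expect_pairField_le_of_spinSq :
    ∀ (L : ℕ) [NeZero L] (N : ℕ) (S : ℝ), 0 ≤ S → ∀ φ : Fock (Orb (FermionTorus 2 L)),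
      φ ∈ szSector N 0 → spinSq *ᵥ φ = ((S * (S + 1) : ℝ) : ℂ) • φ →
      (expect ((pairField dWaveFormFactor L)ᴴ * pairField dWaveFormFactor L) φ).re ≤
        32 * (L : ℝ) ^ 2 * ((N : ℝ) / 2 - S) * (star φ ⬝ᵥ φ).re := by
  intro L _ N S hS φ hφ hspin
  have hsec := ss_isInSector_of_mem_szSector_zero hφ
  have hT : ∀ (a b : ℕ) (ψ : Fock (Orb (FermionTorus 2 L))), IsInSector a b ψ →
      (star ψ ⬝ᵥ (((pairField dWaveFormFactor L)ᴴ * pairField dWaveFormFactor L) *ᵥ ψ)).re ≤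
        32 * (L : ℝ) ^ 2 * b * (star ψ ⬝ᵥ ψ).re :=
    fun a b ψ hψ => pairField_dWave_sector_bound L a b ψ hψ
  have h := ss_bound_of_spinSq _ _ hT (ss_spinMinus_commute_pairField_conjTranspose_mul L dWaveFormFactor)
    (N / 2) (N / 2) φ S hsec hspin hS
  rw [Literature.MathematicalPhysics.QuantumLattice.expect]
  refine h.trans ?_
  have hn0 : 0 ≤ (star φ ⬝ᵥ φ).re := by rw [← eucNorm_sq]; positivity
  have hdiv : (((N / 2 : ℕ) : ℝ) + ((N / 2 : ℕ) : ℝ)) / 2 ≤ (N : ℝ) / 2 := by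
    have := Nat.cast_div_le (m := N) (n := 2) (α := ℝ)
    push_cast at this ⊢
    linarith
  have hL : (0 : ℝ) ≤ 32 * (L : ℝ) ^ 2 := by positivity
  exact mul_le_mul_of_nonneg_right (mul_le_mul_of_nonneg_left (by linarith) hL) hn0

end SqueezeMain

end Summit.HubbardSuperconductivity.HubbardSuperconductivity.Theorems.DeformationLadder

end
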